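/-
Copyright (c) 2026 the pub-hodgecm-mathlib formalisation cell (harness21).  Prover seat hodgecm-mathlib-A-p19 (g27), 2026-09-02.  Road «S3-tree»∕«S3-ram» (LEAD F0P3a-plan (g12)
T11-41∕T11-52; owner p06 (g15)), row «R2²-ram», organ «(D2-γ)-ram: THE TOKEN-LEVEL LAW AT A TAME-RAMIFIED CM PLACE, BOTH TORUS TYPES» — ★ `TypeTwoSelfDualCyclicEigenDataLaw`
(engine) fed with ★ p847397 `RationalGoodVectorRamifiedPlace` (the frame-level law); = FILE 2b of F0P3a-p08 (g19)'s R2²-ram FILE 2 (the `rw` of its ∃-guard).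
-/
import Literature.NumberTheory.Automorphic.TypeTwoSelfDualCyclicEigenDataLaw   -- ★-to-be (this seat): `exists_selfDual_cyclic_iff_rational_norm_of_frameLaw`
import Literature.NumberTheory.Automorphic.RationalGoodVectorRamifiedPlace     -- ★ p847397 (this seat): `exists_selfDual_cyclic_iff_rational_norm_type{A,B}_of_ramified`
import HarnessLib

/-!
# The token-level law at a tame-ramified CM place: self-dual `τ`-cyclic lattices exist iff `d₀·det J·χ_λ(u)∕((1+u)²χ_λ(−1))` is a `σ_w`-norm (Rogawski §4.9; Jacobowitz §7)

Topic `NumberTheory/Automorphic`; namespace `Literature.NumberTheory.Automorphic.SymmetricEigenframe`.  THEOREMS ONLY (no definition, no instance, no notation, no named fact, no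
`sorry`); kernel lane `--supports stmt-HodgeConjecture-24833`.  Cell `pub/hodgecm-mathlib` (D-0151), crux H413; road «S3-tree», seeding wave «S3-ram», row «R2²-ram»; organ **«(D2-γ)-ram
TOKEN-LEVEL LAW»** (this seat) = the ramified twin of ★ B-p14 (g37) `exists_selfDual_cyclic_iff_even_log` ((D2-γ-CM), inert).  Frame of ★ `RationalGoodVectorRamifiedPlace`: `F ∕ F₀`
(`L ∕ L⁺`), `c ≠ 1`, `w₀ ∣ v₀` fixed, RAMIFIED, TAME; `σ := galAdicCompletionMap c hw₀` on `F_{w₀} = L_w`; `M ∕ F`, `w ∣ w₀`, `K := M_w`, `ι₁ := toPlace w₀.1 w`; `ε` a `σ`-fixed unit with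
non-square residue, `θ² = ι₁ε` with the unramified coordinates, the involutions `s̃` (over `σ`, `s̃θ = θ`) and `ι′` (over `id`, `ι′θ = −θ`); the CM involution of `K` is `σ_K := s̃`
(TYPE A) or `s̃ ∘ ι′` (TYPE B).  Token data ((D1)-ram): `J ∈ GL₃(𝒪_{w₀})` `σ`-hermitian, `τ` unitary with `χ_τ = (X − u)(X² − tX + D)`, `σu·u = 1`, `|u − 1| < 1`, a rational
`u`-eigenvector `x₀ ≠ 0`, an eigenvalue `λ ∈ K` with `λ² − ι₁t·λ + ι₁D = 0`, `|λ − 1| < 1`, `λ·σ_Kλ = 1`, `ι′λ ≠ λ`.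

* **`exists_selfDual_cyclic_iff_rational_norm_of_eigenData_typeA_of_ramified`**, **`…_typeB_of_ramified`**:
  `(∃ w, ∃ g ∈ U(σ,J), 𝒪[τ]·w = 𝒪³·gᵀ) ↔ ∃ z : F_{w₀}, z·σz·(d₀·det J·((u² − tu + D)∕((1+u)²(1+t+D)))) = 1`, `d₀ = Σ σ(x₀ᵢ)Jᵢₖx₀ₖ` — DEPTH-FREE, the same rational norm
  condition for both types (the type enters only through the (D1) relations among `u, t, D`).  Its Legendre reading is ★ `RamifiedPlaceNormClassReading`.  HONEST LABEL: HC_CM is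
  proved only modulo the 2 remaining named inputs (hLiu418 24832, h413 24833) until rung 0 closes; local algebra, count-neutral.

## References
* [Rogawski1990] J. D. Rogawski, *Automorphic Representations of Unitary Groups in Three Variables* (1990): §4.9 Lemma 4.9.3 p. 56, Prop. 4.9.1 (b) p. 55.
* [Jacobowitz1962] R. Jacobowitz, *Hermitian forms over local fields*, Amer. J. Math. 84 (1962): §7 Thm. 7.1, §8.
* [SerreLocalFields1979] J.-P. Serre, *Local Fields*, GTM 67 (1979): Ch. V §3 Cor. 2.
-/

set_option autoImplicit false

noncomputable section

open Finset Matrix Polynomial NumberField IsDedekindDomain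
open scoped MatrixGroups ValuativeRel WithZero
open ValuativeRel

namespace Literature.NumberTheory.Automorphic.SymmetricEigenframe

open Literature.NumberTheory.Automorphic Literature.NumberTheory.Automorphic.UnitaryGroup Literature.NumberTheory.NumberFields

variable {F₀ F : Type} (M : Type) [Field F₀] [NumberField F₀] [Field F] [NumberField F] [Field M] [NumberField M]
  [Algebra F₀ F] [Algebra.IsQuadraticExtension F₀ F] [Algebra F M]
  (c : F ≃ₐ[F₀] F) (hc : c ≠ 1) (v₀ : HeightOneSpectrum (𝓞 F₀)) (w₀ : UnitaryGroup.PlacesOver F v₀) (hw₀ : c • w₀.1 = w₀.1) (w : UnitaryGroup.PlacesOver M w₀.1)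

include hc in
/-- **(D2-γ)-ram TOKEN-LEVEL LAW, TORUS TYPE A** (`σ_K := s̃`): self-dual `τ`-cyclic lattices exist iff `d₀·det J·(u² − tu + D)∕((1+u)²(1+t+D))` is a `σ_{w₀}`-norm.
★ engine `exists_selfDual_cyclic_iff_rational_norm_of_frameLaw` with `hlaw` := ★ `exists_selfDual_cyclic_iff_rational_norm_typeA_of_ramified`.
[cite: Rogawski1990, §4.9 Lemma 4.9.3 p. 56, Prop. 4.9.1 (b) p. 55] [cite: Jacobowitz1962, §7 Thm. 7.1] [cite: SerreLocalFields1979, Ch. V §3 Cor. 2] -/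
theorem exists_selfDual_cyclic_iff_rational_norm_of_eigenData_typeA_of_ramified (he : v₀.asIdeal.ramificationIdx' w₀.1.asIdeal ≠ 1)
    (h2 : Valued.v (2 : w₀.1.adicCompletion F) = 1)
    {ε : w₀.1.adicCompletion F} (hσε : galAdicCompletionMap (L := F) c hw₀ ε = ε) (hε1 : Valued.v ε = 1)
    (hεres : ∀ r : w₀.1.adicCompletion F, Valued.v r ≤ 1 → ¬ Valued.v (ε - r ^ 2) < 1)
    {θ : w.1.adicCompletion M} (hθ : θ ^ 2 = toPlace w₀.1 w ε)
    (hval : ∀ p q : w₀.1.adicCompletion F, Valued.v (toPlace w₀.1 w p + toPlace w₀.1 w q * θ) = max (Valued.v p) (Valued.v q))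
    (hcoord : ∀ z : w.1.adicCompletion M, ∃ pq : w₀.1.adicCompletion F × w₀.1.adicCompletion F, z = toPlace w₀.1 w pq.1 + toPlace w₀.1 w pq.2 * θ)
    (s' ι' : w.1.adicCompletion M →+* w.1.adicCompletion M)
    (hs' : ∀ x, s' (toPlace w₀.1 w x) = toPlace w₀.1 w (galAdicCompletionMap (L := F) c hw₀ x)) (hs'θ : s' θ = θ)
    (hs's' : ∀ z, s' (s' z) = z) (hs'v : ∀ z, Valued.v (s' z) = Valued.v z)
    (hι' : ∀ x, ι' (toPlace w₀.1 w x) = toPlace w₀.1 w x) (hι'θ : ι' θ = -θ) (hι'ι' : ∀ z, ι' (ι' z) = z) (hι'v : ∀ z, Valued.v (ι' z) = Valued.v z)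
    (hcomm : ∀ z, s' (ι' z) = ι' (s' z)) (hfix : ∀ z : w.1.adicCompletion M, ι' z = z → ∃ x, toPlace w₀.1 w x = z)
    (J : GL (Fin 3) (w₀.1.adicCompletion F)) (hJ : J ∈ glInt 3 (w₀.1.adicCompletion F))
    (hJh : ((J : Matrix (Fin 3) (Fin 3) (w₀.1.adicCompletion F)).map (galAdicCompletionMap (L := F) c hw₀))ᵀ = J)
    (τ : Matrix (Fin 3) (Fin 3) (w₀.1.adicCompletion F))
    (hτU : (τ.map (galAdicCompletionMap (L := F) c hw₀))ᵀ * (J : Matrix (Fin 3) (Fin 3) (w₀.1.adicCompletion F)) * τ = J)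
    {u t D : w₀.1.adicCompletion F} (hχ : τ.charpoly = (X - C u) * (X ^ 2 - C t * X + C D))
    (hσu : galAdicCompletionMap (L := F) c hw₀ u * u = 1) (hu1 : Valued.v (u - 1) < 1)
    {x₀ : Fin 3 → w₀.1.adicCompletion F} (hx₀ : τ *ᵥ x₀ = u • x₀) (hx₀0 : x₀ ≠ 0)
    {lam : w.1.adicCompletion M} (hquad : lam ^ 2 - toPlace w₀.1 w t * lam + toPlace w₀.1 w D = 0) (hlam1 : Valued.v (lam - 1) < 1)
    (hσlam : lam * s' lam = 1) (hne : ι' lam ≠ lam) :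
    (∃ w' : Fin 3 → w₀.1.adicCompletion F, ∃ g ∈ unitaryGroupOfForm (galAdicCompletionMap (L := F) c hw₀) (J : Matrix (Fin 3) (Fin 3) (w₀.1.adicCompletion F)),
      Submodule.span 𝒪[w₀.1.adicCompletion F] (Set.range fun k : Fin 3 => (τ ^ (k : ℕ)) *ᵥ w') =
        Submodule.span 𝒪[w₀.1.adicCompletion F] (Set.range ((g : Matrix (Fin 3) (Fin 3) (w₀.1.adicCompletion F)))ᵀ)) ↔
    ∃ z : w₀.1.adicCompletion F, z * galAdicCompletionMap (L := F) c hw₀ z *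
      ((∑ k, ∑ i, galAdicCompletionMap (L := F) c hw₀ (x₀ i) * (J : Matrix (Fin 3) (Fin 3) (w₀.1.adicCompletion F)) i k * x₀ k) *
        (J : Matrix (Fin 3) (Fin 3) (w₀.1.adicCompletion F)).det * ((u ^ 2 - t * u + D) / ((1 + u) ^ 2 * (1 + t + D)))) = 1 := by
  have hιv : ∀ x, Valued.v (toPlace w₀.1 w x) = Valued.v x := fun x => by
    have h := hval x 0
    rwa [map_zero, zero_mul, add_zero, map_zero, max_eq_left zero_le] at h
  have hθv : Valued.v θ = 1 := by
    have h := hval 0 1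
    rwa [map_zero, map_one, zero_add, one_mul, map_zero, map_one, max_eq_right zero_le] at h
  have hθ0 : θ ≠ 0 := fun h => by rw [h, map_zero] at hθv; exact zero_ne_one hθv
  have hσσ : ∀ x, galAdicCompletionMap (L := F) c hw₀ (galAdicCompletionMap (L := F) c hw₀ x) = x := fun x =>
    galAdicCompletionMap_galAdicCompletionMap_of_smul_eq c w₀ hc hw₀ x
  exact exists_selfDual_cyclic_iff_rational_norm_of_frameLaw (galAdicCompletionMap (L := F) c hw₀) hσσ h2 J hJh τ hτU hχ hσu hu1 hx₀ hx₀0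
    (toPlace w₀.1 w) hιv s' ι' hs' hs's' hs'v hι' hι'ι' hι'v hcomm hfix hθ0 hι'θ hquad hlam1 hσlam hne
    (fun P γ d r hτ hP hP0 hP1 hP2 hγ hinj hσγ hr hγ1u hγne hγc hιγ0 hιγ1 hιγ2 hdσ hdne hιd0 hιd1 =>
      exists_selfDual_cyclic_iff_rational_norm_typeA_of_ramified M c hc v₀ w₀ hw₀ w he h2 hσε hε1 hεres hθ hval hcoord s' ι' hs' hs'θ hs's' hs'v
        hι' hι'θ hι'ι' hι'v hcomm hfix J hJ hJh τ P hτ hP hP0 hP1 hP2 hγ hinj hσγ hr hγ1u hγne hγc hιγ0 hιγ1 hιγ2 hdσ hdne hιd0 hιd1)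

include hc in
/-- **(D2-γ)-ram TOKEN-LEVEL LAW, TORUS TYPE B** (`σ_K := s̃ ∘ ι′`): the same rational norm condition.  ★ engine with `hlaw` := ★ `exists_selfDual_cyclic_iff_rational_norm_typeB_of_ramified`.
[cite: Rogawski1990, §4.9 Lemma 4.9.3 p. 56, Prop. 4.9.1 (b) p. 55] [cite: Jacobowitz1962, §7 Thm. 7.1] [cite: SerreLocalFields1979, Ch. V §2 Prop. 3] -/
theorem exists_selfDual_cyclic_iff_rational_norm_of_eigenData_typeB_of_ramified (he : v₀.asIdeal.ramificationIdx' w₀.1.asIdeal ≠ 1)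
    (h2 : Valued.v (2 : w₀.1.adicCompletion F) = 1)
    {ε : w₀.1.adicCompletion F} (hσε : galAdicCompletionMap (L := F) c hw₀ ε = ε) (hε1 : Valued.v ε = 1)
    (hεres : ∀ r : w₀.1.adicCompletion F, Valued.v r ≤ 1 → ¬ Valued.v (ε - r ^ 2) < 1)
    {θ : w.1.adicCompletion M} (hθ : θ ^ 2 = toPlace w₀.1 w ε)
    (hval : ∀ p q : w₀.1.adicCompletion F, Valued.v (toPlace w₀.1 w p + toPlace w₀.1 w q * θ) = max (Valued.v p) (Valued.v q))
    (hcoord : ∀ z : w.1.adicCompletion M, ∃ pq : w₀.1.adicCompletion F × w₀.1.adicCompletion F, z = toPlace w₀.1 w pq.1 + toPlace w₀.1 w pq.2 * θ)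
    (s' ι' : w.1.adicCompletion M →+* w.1.adicCompletion M)
    (hs' : ∀ x, s' (toPlace w₀.1 w x) = toPlace w₀.1 w (galAdicCompletionMap (L := F) c hw₀ x)) (hs'θ : s' θ = θ)
    (hs's' : ∀ z, s' (s' z) = z) (hs'v : ∀ z, Valued.v (s' z) = Valued.v z)
    (hι' : ∀ x, ι' (toPlace w₀.1 w x) = toPlace w₀.1 w x) (hι'θ : ι' θ = -θ) (hι'ι' : ∀ z, ι' (ι' z) = z) (hι'v : ∀ z, Valued.v (ι' z) = Valued.v z)
    (hcomm : ∀ z, s' (ι' z) = ι' (s' z)) (hfix : ∀ z : w.1.adicCompletion M, ι' z = z → ∃ x, toPlace w₀.1 w x = z)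
    (J : GL (Fin 3) (w₀.1.adicCompletion F)) (hJ : J ∈ glInt 3 (w₀.1.adicCompletion F))
    (hJh : ((J : Matrix (Fin 3) (Fin 3) (w₀.1.adicCompletion F)).map (galAdicCompletionMap (L := F) c hw₀))ᵀ = J)
    (τ : Matrix (Fin 3) (Fin 3) (w₀.1.adicCompletion F))
    (hτU : (τ.map (galAdicCompletionMap (L := F) c hw₀))ᵀ * (J : Matrix (Fin 3) (Fin 3) (w₀.1.adicCompletion F)) * τ = J)
    {u t D : w₀.1.adicCompletion F} (hχ : τ.charpoly = (X - C u) * (X ^ 2 - C t * X + C D))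
    (hσu : galAdicCompletionMap (L := F) c hw₀ u * u = 1) (hu1 : Valued.v (u - 1) < 1)
    {x₀ : Fin 3 → w₀.1.adicCompletion F} (hx₀ : τ *ᵥ x₀ = u • x₀) (hx₀0 : x₀ ≠ 0)
    {lam : w.1.adicCompletion M} (hquad : lam ^ 2 - toPlace w₀.1 w t * lam + toPlace w₀.1 w D = 0) (hlam1 : Valued.v (lam - 1) < 1)
    (hσlam : lam * (s'.comp ι') lam = 1) (hne : ι' lam ≠ lam) :
    (∃ w' : Fin 3 → w₀.1.adicCompletion F, ∃ g ∈ unitaryGroupOfForm (galAdicCompletionMap (L := F) c hw₀) (J : Matrix (Fin 3) (Fin 3) (w₀.1.adicCompletion F)),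
      Submodule.span 𝒪[w₀.1.adicCompletion F] (Set.range fun k : Fin 3 => (τ ^ (k : ℕ)) *ᵥ w') =
        Submodule.span 𝒪[w₀.1.adicCompletion F] (Set.range ((g : Matrix (Fin 3) (Fin 3) (w₀.1.adicCompletion F)))ᵀ)) ↔
    ∃ z : w₀.1.adicCompletion F, z * galAdicCompletionMap (L := F) c hw₀ z *
      ((∑ k, ∑ i, galAdicCompletionMap (L := F) c hw₀ (x₀ i) * (J : Matrix (Fin 3) (Fin 3) (w₀.1.adicCompletion F)) i k * x₀ k) *
        (J : Matrix (Fin 3) (Fin 3) (w₀.1.adicCompletion F)).det * ((u ^ 2 - t * u + D) / ((1 + u) ^ 2 * (1 + t + D)))) = 1 := by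
  have hιv : ∀ x, Valued.v (toPlace w₀.1 w x) = Valued.v x := fun x => by
    have h := hval x 0
    rwa [map_zero, zero_mul, add_zero, map_zero, max_eq_left zero_le] at h
  have hθv : Valued.v θ = 1 := by
    have h := hval 0 1
    rwa [map_zero, map_one, zero_add, one_mul, map_zero, map_one, max_eq_right zero_le] at h
  have hθ0 : θ ≠ 0 := fun h => by rw [h, map_zero] at hθv; exact zero_ne_one hθv
  have hσσ : ∀ x, galAdicCompletionMap (L := F) c hw₀ (galAdicCompletionMap (L := F) c hw₀ x) = x := fun x =>
    galAdicCompletionMap_galAdicCompletionMap_of_smul_eq c w₀ hc hw₀ x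
  have hσKj : ∀ x, (s'.comp ι') (toPlace w₀.1 w x) = toPlace w₀.1 w (galAdicCompletionMap (L := F) c hw₀ x) := fun x => by
    rw [RingHom.comp_apply, hι', hs']
  have hσKv : ∀ z, Valued.v ((s'.comp ι') z) = Valued.v z := fun z => by rw [RingHom.comp_apply, hs'v, hι'v]
  have hσKσK : ∀ z, (s'.comp ι') ((s'.comp ι') z) = z := fun z => by
    rw [RingHom.comp_apply, RingHom.comp_apply, ← hcomm, hs's', hι'ι']
  have hσKι : ∀ z, (s'.comp ι') (ι' z) = ι' ((s'.comp ι') z) := fun z => by rw [RingHom.comp_apply, RingHom.comp_apply, hcomm]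
  exact exists_selfDual_cyclic_iff_rational_norm_of_frameLaw (galAdicCompletionMap (L := F) c hw₀) hσσ h2 J hJh τ hτU hχ hσu hu1 hx₀ hx₀0
    (toPlace w₀.1 w) hιv (s'.comp ι') ι' hσKj hσKσK hσKv hι' hι'ι' hι'v hσKι hfix hθ0 hι'θ hquad hlam1 hσlam hne
    (fun P γ d r hτ hP hP0 hP1 hP2 hγ hinj hσγ hr hγ1u hγne hγc hιγ0 hιγ1 hιγ2 hdσ hdne hιd0 hιd1 =>
      exists_selfDual_cyclic_iff_rational_norm_typeB_of_ramified M c hc v₀ w₀ hw₀ w he h2 hσε hε1 hεres hθ hval hcoord s' ι' hs' hs'θ hs's' hs'v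
        hι' hι'θ hι'ι' hι'v hcomm hfix J hJ hJh τ P hτ hP hP0 hP1 hP2 hγ hinj hσγ hr hγ1u hγne hγc hιγ0 hιγ1 hιγ2 hdσ hdne hιd0 hιd1)

end Literature.NumberTheory.Automorphic.SymmetricEigenframe

end
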